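import Summits.ResolutionOfSingularities.ResolutionOfSingularities.Theorems.RadicialJungCleanModelsCcurvePersistOne
import HarnessLib

/-!
# Route `RadicialJung`, crux `CleanModels` (stmt-15917) — (C-curve) sub-line: closed-point persist, TWO curve factors (core of `stub_Cc_persistForm1`, case `m = 2`)

Lead `res-B-lead-1` g7 (plan `Cruxes/CleanModels/Lines/Sketch-memo-Ccurve-plan.md` §1 S5c/S5d; workfile `Lines/Sketch_Ccurve_assembly.lean` v2.8).
OURS · counted 0.  Nothing here proves resolution in characteristic `p`; resolution in char `p` is NOT proved.

`persist_two_core`: in the output situation of the centre-curve node (`S' = locAtCentre B' O`, r.s.p. `(x, y, z)`, `(x, y)` the centre of `O₁`), a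
representative `Σ c_j^p g₀^j = A₀ · (x α₀ + y β₀)^{n₀} · (x α₁ + y β₁)^{n₁}` (`A₀` a `v₁`-unit; rows decomposed along the curve at orders `e₀, e₁` with
unimodular leading rows, row `0` ORIENTED (`a₀'` a unit); conormal determinant `α₀ β₁ − α₁ β₀` a `v₁`-unit; `p ∤ n₀, n₁`) becomes loosely clean of
FORM (1) on a model obtained by point blow-ups and curve blow-ups along `O`:
* `N = e_a + e₀ + e₁ + g` point blow-ups (✓ `pointPrep_weak`; `g` the `z̄`-order of the determinant): `x α_i + y β_i = z^{N+e_i} ℓ_i`, `ℓ_i = u_i x_N + v_i y_N`,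
  `Δ = u₀ v₁ − u₁ v₀ = z^{g'} ·` unit;
* non-tangent (`Δ` a unit): `(z, ℓ₀, ℓ₁)` is an r.s.p. ⇒ ✓ `pack_two`;
* TANGENT (`g' ≥ 1`): `u₁` is a unit, normal form `ℓ₁ ∝ x̃ + z^{g'} ỹ` with `x̃ = ℓ₀`, `(x̃, z, ỹ)` an r.s.p.; the `g'` Γ-rounds (blow-ups of `V(x̃, z) ≠ C`,
  an isomorphism at the generic point of the centre curve) are ONE call of ✓ `exists_model_rsop_div_pow` with `(t, t₂, t₃) := (x̃, z, ỹ)`, `n := g'`: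
  `x̃ = x' z^{g'}`, `ℓ₁ ∝ z^{g'} (x' + ỹ)`, `(z, x', x' + ỹ)` an r.s.p. ⇒ ✓ `pack_two`.
Point blow-ups alone never separate tangent factors (the contact order `g'` is intrinsic), hence the curve rounds.
-/

noncomputable section

set_option linter.dupNamespace false

open IsLocalRing Literature.AlgebraicGeometry.Resolution
open Summit.ResolutionOfSingularities.ResolutionOfSingularities.Theorems

namespace Summit.ResolutionOfSingularities.ResolutionOfSingularities.Theorems.RadicialJung.CleanModels.Ccurve

variable {K : Type} [Field K]

/-- Membership in a three-generated ideal of a subring of `K` from an explicit combination in `K`. [folklore] -/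
theorem mem_span_triple_of_eq {R : Subring K} {w a b c : K} (hw : w ∈ R) (ha : a ∈ R) (hb : b ∈ R) (hc : c ∈ R)
    (r s t : K) (hr : r ∈ R) (hs : s ∈ R) (ht : t ∈ R) (h : w = r * a + s * b + t * c) :
    (⟨w, hw⟩ : ↥R) ∈ Ideal.span ({⟨a, ha⟩, ⟨b, hb⟩, ⟨c, hc⟩} : Set ↥R) := by
  have : (⟨w, hw⟩ : ↥R) = ⟨r, hr⟩ * ⟨a, ha⟩ + ⟨s, hs⟩ * ⟨b, hb⟩ + ⟨t, ht⟩ * ⟨c, hc⟩ := Subtype.ext h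
  rw [this]
  exact Ideal.add_mem _ (Ideal.add_mem _ (Ideal.mul_mem_left _ _ (Ideal.subset_span (by simp)))
    (Ideal.mul_mem_left _ _ (Ideal.subset_span (by simp)))) (Ideal.mul_mem_left _ _ (Ideal.subset_span (by simp)))

/-- Two three-generated ideals of a subring of `K` coincide when each generator of either is an explicit combination of the other's. [folklore] -/
theorem span_triple_eq_of_mem {R : Subring K} {a b c a' b' c' : ↥R}
    (h₁ : a ∈ Ideal.span ({a', b', c'} : Set ↥R)) (h₂ : b ∈ Ideal.span ({a', b', c'} : Set ↥R)) (h₃ : c ∈ Ideal.span ({a', b', c'} : Set ↥R))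
    (h₁' : a' ∈ Ideal.span ({a, b, c} : Set ↥R)) (h₂' : b' ∈ Ideal.span ({a, b, c} : Set ↥R)) (h₃' : c' ∈ Ideal.span ({a, b, c} : Set ↥R)) :
    Ideal.span ({a, b, c} : Set ↥R) = Ideal.span {a', b', c'} := by
  apply le_antisymm
  · rw [Ideal.span_le, Set.insert_subset_iff, Set.insert_subset_iff, Set.singleton_subset_iff]
    exact ⟨h₁, h₂, h₃⟩
  · rw [Ideal.span_le, Set.insert_subset_iff, Set.insert_subset_iff, Set.singleton_subset_iff]
    exact ⟨h₁', h₂', h₃'⟩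

/-- **Closed-point persist, two curve factors (core; row `0` oriented).**  See the module docstring. [folklore] -/
theorem persist_two_core {k : Type} [Field k] [Algebra k K] (p : ℕ) (hp : p.Prime)
    (O : ValuationSubring K) (A : Subalgebra k K) (hAO : A.toSubring ≤ O.toSubring) (hAfg : A.FG) [IsFractionRing A K]
    (hdimA : ringKrullDim A ≤ 3)
    (hzd : ∀ (T : Subring K) (hT : T ≤ O.toSubring), A.toSubring ≤ T → (subringCentre T O hT).IsMaximal)
    (B' : Subalgebra k K) (hB'O : B'.toSubring ≤ O.toSubring) (hAB' : A ≤ B') (hB'fg : B'.FG)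
    (hB'reg : IsRegularLocalRing (locAtCentre B'.toSubring O)) (hB'dim : ringKrullDim (locAtCentre B'.toSubring O) = 3)
    (O₁ : ValuationSubring K) (hOO₁ : O ≤ O₁)
    (x y z : K) (hx : x ∈ locAtCentre B'.toSubring O) (hy : y ∈ locAtCentre B'.toSubring O) (hz : z ∈ locAtCentre B'.toSubring O)
    (hmax : (haveI := isLocalRing_locAtCentre hB'O; IsLocalRing.maximalIdeal (locAtCentre B'.toSubring O)) =
        Ideal.span {⟨x, hx⟩, ⟨y, hy⟩, ⟨z, hz⟩})
    (hcen : ∀ w : ↥(locAtCentre B'.toSubring O), O₁.valuation (w : K) < 1 ↔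
        w ∈ Ideal.span {(⟨x, hx⟩ : ↥(locAtCentre B'.toSubring O)), ⟨y, hy⟩})
    (g₀ : K) (c : Fin p → K) (hc : ∃ j : Fin p, (j : ℕ) ≠ 0 ∧ c j ≠ 0)
    (A₀ : K) (hA₀ : A₀ ∈ locAtCentre B'.toSubring O) (hvA₀ : O₁.valuation A₀ = 1)
    (α₀ β₀ α₁ β₁ : K) (e₀ e₁ : ℕ) (a₀' b₀' a₀₁ a₀₂ b₀₁ b₀₂ a₁' b₁' a₁₁ a₁₂ b₁₁ b₁₂ : K)
    (ha₀' : a₀' ∈ locAtCentre B'.toSubring O) (hb₀' : b₀' ∈ locAtCentre B'.toSubring O)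
    (ha₀₁ : a₀₁ ∈ locAtCentre B'.toSubring O) (ha₀₂ : a₀₂ ∈ locAtCentre B'.toSubring O)
    (hb₀₁ : b₀₁ ∈ locAtCentre B'.toSubring O) (hb₀₂ : b₀₂ ∈ locAtCentre B'.toSubring O)
    (ha₁' : a₁' ∈ locAtCentre B'.toSubring O) (hb₁' : b₁' ∈ locAtCentre B'.toSubring O)
    (ha₁₁ : a₁₁ ∈ locAtCentre B'.toSubring O) (ha₁₂ : a₁₂ ∈ locAtCentre B'.toSubring O)
    (hb₁₁ : b₁₁ ∈ locAtCentre B'.toSubring O) (hb₁₂ : b₁₂ ∈ locAtCentre B'.toSubring O)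
    (hα₀ : α₀ = a₀' * z ^ e₀ + x * a₀₁ + y * a₀₂) (hβ₀ : β₀ = b₀' * z ^ e₀ + x * b₀₁ + y * b₀₂)
    (hα₁ : α₁ = a₁' * z ^ e₁ + x * a₁₁ + y * a₁₂) (hβ₁ : β₁ = b₁' * z ^ e₁ + x * b₁₁ + y * b₁₂)
    (hva₀' : O.valuation a₀' = 1) (huni₁ : O.valuation a₁' = 1 ∨ O.valuation b₁' = 1)
    (hdet : O₁.valuation (α₀ * β₁ - α₁ * β₀) = 1)
    (n₀ n₁ : ℕ) (hn₀ : ¬ p ∣ n₀) (hn₁ : ¬ p ∣ n₁)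
    (hG : (∑ j : Fin p, c j ^ p * g₀ ^ (j : ℕ)) = A₀ * (x * α₀ + y * β₀) ^ n₀ * (x * α₁ + y * β₁) ^ n₁) :
    ∃ (A' : Subalgebra k K), A'.toSubring ≤ O.toSubring ∧ A ≤ A' ∧ A'.FG ∧
    ∃ (_ : IsRegularLocalRing ↥(locAtCentre A'.toSubring O)) (c : Fin p → K), (∃ j : Fin p, (j : ℕ) ≠ 0 ∧ c j ≠ 0) ∧
    ((∃ (d m : ℕ) (hmd : m ≤ d) (t : Fin d → ↥(locAtCentre A'.toSubring O)) (a : Fin m → ℕ) (u : ↥(locAtCentre A'.toSubring O)), IsUnit u ∧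
    Ideal.span (Set.range t) = IsLocalRing.maximalIdeal ↥(locAtCentre A'.toSubring O) ∧
    ringKrullDim ↥(locAtCentre A'.toSubring O) = (d : WithBot ℕ∞) ∧ 0 < m ∧ (∀ i, ¬ p ∣ a i) ∧
    (∑ j : Fin p, c j ^ p * g₀ ^ (j : ℕ)) = (u : K) * ∏ i : Fin m, ((t (Fin.castLE hmd i) : ↥(locAtCentre A'.toSubring O)) : K) ^ (a i)) ∨
    (∃ u : ↥(locAtCentre A'.toSubring O), IsUnit u ∧ (∑ j : Fin p, c j ^ p * g₀ ^ (j : ℕ)) = (u : K) ∧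
    ∀ c' : ↥(locAtCentre A'.toSubring O), u - c' ^ p ∉ IsLocalRing.maximalIdeal ↥(locAtCentre A'.toSubring O)) ∨
    (∃ s c' : ↥(locAtCentre A'.toSubring O), (∑ j : Fin p, c j ^ p * g₀ ^ (j : ℕ)) = (s : K) ∧
    s - c' ^ p ∈ IsLocalRing.maximalIdeal ↥(locAtCentre A'.toSubring O) ∧
    s - c' ^ p ∉ IsLocalRing.maximalIdeal ↥(locAtCentre A'.toSubring O) ^ 2)) := by
  classical
  haveI := isLocalRing_locAtCentre hB'O
  haveI : IsRegularLocalRing ↥(locAtCentre B'.toSubring O) := hB'reg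
  obtain ⟨hvz₁, hvx₁, hvy₁⟩ := valuation_coarse_z_eq_one hB'O hOO₁ hB'dim hx hy hz hmax hcen
  have hz0 : z ≠ 0 := ne_zero_of_valuation_eq_one hvz₁
  -- `dim A = 3`
  have hdimA3 : ringKrullDim A = 3 := by
    rw [← ringKrullDim_eq_of_fg_of_le hAfg hB'fg hAB', ← ringKrullDim_locAtCentre_eq_of_isMaximal B' hB'fg O hB'O (hzd _ hB'O fun w hw => hAB' hw)]
    exact hB'dim
  -- orders of `A₀` and of the determinant
  obtain ⟨ea, Ua, c₁, c₂, hUa, hc₁, hc₂, hvUa, hA₀eq⟩ := exists_eq_unit_mul_pow_add_K hB'O hOO₁ hB'dim hx hy hz hmax hcen hA₀ hvA₀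
  have hα₀m : α₀ ∈ locAtCentre B'.toSubring O := by
    rw [hα₀]; exact Subring.add_mem _ (Subring.add_mem _ (Subring.mul_mem _ ha₀' (Subring.pow_mem _ hz _)) (Subring.mul_mem _ hx ha₀₁))
      (Subring.mul_mem _ hy ha₀₂)
  have hβ₀m : β₀ ∈ locAtCentre B'.toSubring O := by
    rw [hβ₀]; exact Subring.add_mem _ (Subring.add_mem _ (Subring.mul_mem _ hb₀' (Subring.pow_mem _ hz _)) (Subring.mul_mem _ hx hb₀₁))
      (Subring.mul_mem _ hy hb₀₂)
  have hα₁m : α₁ ∈ locAtCentre B'.toSubring O := by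
    rw [hα₁]; exact Subring.add_mem _ (Subring.add_mem _ (Subring.mul_mem _ ha₁' (Subring.pow_mem _ hz _)) (Subring.mul_mem _ hx ha₁₁))
      (Subring.mul_mem _ hy ha₁₂)
  have hβ₁m : β₁ ∈ locAtCentre B'.toSubring O := by
    rw [hβ₁]; exact Subring.add_mem _ (Subring.add_mem _ (Subring.mul_mem _ hb₁' (Subring.pow_mem _ hz _)) (Subring.mul_mem _ hx hb₁₁))
      (Subring.mul_mem _ hy hb₁₂)
  have hDm : α₀ * β₁ - α₁ * β₀ ∈ locAtCentre B'.toSubring O :=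
    Subring.sub_mem _ (Subring.mul_mem _ hα₀m hβ₁m) (Subring.mul_mem _ hα₁m hβ₀m)
  obtain ⟨g, Ud, d₁, d₂, hUd, hd₁, hd₂, hvUd, hDeq⟩ := exists_eq_unit_mul_pow_add_K hB'O hOO₁ hB'dim hx hy hz hmax hcen hDm hdet
  -- `N = ea + e₀ + e₁ + g` point blow-ups
  obtain ⟨B'', hB''O, hAB'', hB''fg, hB''reg, hB''dim, hSS, h₁, h₂, h₃, hmax''⟩ :=
    pointPrep_weak k K O A hAO hAfg ‹_› hdimA hzd B' hB'O hAB' hB'fg hB'reg hB'dim O₁ hOO₁ x y z hx hy hz hmax hcen (ea + e₀ + e₁ + g)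
  haveI := isLocalRing_locAtCentre hB''O
  haveI : IsRegularLocalRing ↥(locAtCentre B''.toSubring O) := hB''reg
  set xn : K := x / z ^ (ea + e₀ + e₁ + g) with hxn
  set yn : K := y / z ^ (ea + e₀ + e₁ + g) with hyn
  have hxe : x = xn * z ^ (ea + e₀ + e₁ + g) := by rw [hxn]; field_simp
  have hye : y = yn * z ^ (ea + e₀ + e₁ + g) := by rw [hyn]; field_simp
  obtain ⟨hvxn, hvyn, hvz⟩ := valuation_lt_one_of_gen hB''O h₁ h₂ h₃ hmax''
  have hRO : locAtCentre B''.toSubring O ≤ O.toSubring := locAtCentre_le hB''O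
  have hB''O₁ : B''.toSubring ≤ O₁.toSubring := fun w hw => hOO₁ (hB''O hw)
  -- lift `A₀`, the four coefficients and the determinant
  obtain ⟨Wa, hWa, hA₀up, hWa1, -⟩ := lift_term (O := O) hRO h₃ h₁ h₂ (hSS hUa) (hSS hc₁) (hSS hc₂) hvxn hvyn
    (show ea ≤ ea + e₀ + e₁ + g by omega) hxe hye
  have hvWa : O.valuation Wa = 1 := hWa1 hvUa
  obtain ⟨u₀, hu₀, hα₀up, hu₀1, -⟩ := lift_term (O := O) hRO h₃ h₁ h₂ (hSS ha₀') (hSS ha₀₁) (hSS ha₀₂) hvxn hvyn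
    (show e₀ ≤ ea + e₀ + e₁ + g by omega) hxe hye
  obtain ⟨v₀, hv₀, hβ₀up, -, -⟩ := lift_term (O := O) hRO h₃ h₁ h₂ (hSS hb₀') (hSS hb₀₁) (hSS hb₀₂) hvxn hvyn
    (show e₀ ≤ ea + e₀ + e₁ + g by omega) hxe hye
  obtain ⟨u₁, hu₁, hα₁up, hu₁1, hu₁2⟩ := lift_term (O := O) hRO h₃ h₁ h₂ (hSS ha₁') (hSS ha₁₁) (hSS ha₁₂) hvxn hvyn
    (show e₁ ≤ ea + e₀ + e₁ + g by omega) hxe hye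
  obtain ⟨v₁, hv₁, hβ₁up, hv₁1, -⟩ := lift_term (O := O) hRO h₃ h₁ h₂ (hSS hb₁') (hSS hb₁₁) (hSS hb₁₂) hvxn hvyn
    (show e₁ ≤ ea + e₀ + e₁ + g by omega) hxe hye
  obtain ⟨Wd, hWd, hDup, hWd1, -⟩ := lift_term (O := O) hRO h₃ h₁ h₂ (hSS hUd) (hSS hd₁) (hSS hd₂) hvxn hvyn
    (show g ≤ ea + e₀ + e₁ + g by omega) hxe hye
  have hvWd : O.valuation Wd = 1 := hWd1 hvUd
  have hvu₀ : O.valuation u₀ = 1 := hu₀1 hva₀'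
  have hu₀0 : u₀ ≠ 0 := ne_zero_of_valuation_eq_one hvu₀
  have hWd0 : Wd ≠ 0 := ne_zero_of_valuation_eq_one hvWd
  have hu₀inv : u₀⁻¹ ∈ locAtCentre B''.toSubring O := inv_mem_locAtCentre hu₀ hvu₀
  have hWdinv : Wd⁻¹ ∈ locAtCentre B''.toSubring O := inv_mem_locAtCentre hWd hvWd
  -- the curve factors upstairs
  set ℓ₀ : K := u₀ * xn + v₀ * yn with hℓ₀
  set ℓ₁ : K := u₁ * xn + v₁ * yn with hℓ₁
  have hℓ₀m : ℓ₀ ∈ locAtCentre B''.toSubring O := Subring.add_mem _ (Subring.mul_mem _ hu₀ h₁) (Subring.mul_mem _ hv₀ h₂)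
  have hℓ₁m : ℓ₁ ∈ locAtCentre B''.toSubring O := Subring.add_mem _ (Subring.mul_mem _ hu₁ h₁) (Subring.mul_mem _ hv₁ h₂)
  have hα₀z : α₀ = z ^ e₀ * u₀ := by rw [hα₀, hα₀up]
  have hβ₀z : β₀ = z ^ e₀ * v₀ := by rw [hβ₀, hβ₀up]
  have hα₁z : α₁ = z ^ e₁ * u₁ := by rw [hα₁, hα₁up]
  have hβ₁z : β₁ = z ^ e₁ * v₁ := by rw [hβ₁, hβ₁up]
  have hrow₀ : x * α₀ + y * β₀ = z ^ (ea + e₀ + e₁ + g + e₀) * ℓ₀ := by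
    rw [hα₀z, hβ₀z, hxe, hye, hℓ₀, pow_add]; ring
  have hrow₁ : x * α₁ + y * β₁ = z ^ (ea + e₀ + e₁ + g + e₁) * ℓ₁ := by
    rw [hα₁z, hβ₁z, hxe, hye, hℓ₁, pow_add]; ring
  -- the determinant upstairs: `z^(e₀+e₁) Δ = z^g Wd`
  set Δ : K := u₀ * v₁ - u₁ * v₀ with hΔ
  have hΔm : Δ ∈ locAtCentre B''.toSubring O := Subring.sub_mem _ (Subring.mul_mem _ hu₀ hv₁) (Subring.mul_mem _ hu₁ hv₀)
  have hΔeq : z ^ (e₀ + e₁) * Δ = z ^ g * Wd := by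
    have h1 : α₀ * β₁ - α₁ * β₀ = z ^ (e₀ + e₁) * Δ := by rw [hα₀z, hβ₀z, hα₁z, hβ₁z, hΔ, pow_add]; ring
    rw [← h1, hDeq, hDup]
  have hA₀z : A₀ = z ^ ea * Wa := by rw [hA₀eq, hA₀up]
  -- `v₁`-values upstairs
  have hvz₁N : ∀ m : ℕ, O₁.valuation (z ^ m) = 1 := fun m => by rw [map_pow, hvz₁, one_pow]
  have hvxn₁ : O₁.valuation xn < 1 := by rw [hxn, map_div₀, hvz₁N, div_one]; exact hvx₁
  have hvyn₁ : O₁.valuation yn < 1 := by rw [hyn, map_div₀, hvz₁N, div_one]; exact hvy₁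
  rcases (valuation_le_one_of_mem_locAtCentre hB''O hΔm).lt_or_eq with hΔlt | hΔ1
  · /- TANGENT case: `v Δ < 1`, so `g' = g - (e₀ + e₁) ≥ 1`, `u₁` is a unit, normal form `ℓ₁ ∝ x̃ + z^{g'} ỹ` -/
    have hg : e₀ + e₁ < g := by
      by_contra hle
      push Not at hle
      have : Wd = z ^ (e₀ + e₁ - g) * Δ := by
        have hsplit : z ^ (e₀ + e₁) = z ^ g * z ^ (e₀ + e₁ - g) := by rw [← pow_add, Nat.add_sub_cancel' hle]
        have h := hΔeq
        rw [hsplit, mul_assoc] at h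
        exact (mul_left_cancel₀ (pow_ne_zero _ hz0) h).symm
      have hlt : O.valuation Wd < 1 := by
        rw [this, mul_comm]; exact valuation_mul_lt_one_of_lt_of_mem O hΔlt (hRO (Subring.pow_mem _ h₃ _))
      rw [hvWd] at hlt; exact lt_irrefl _ hlt
    set g' : ℕ := g - (e₀ + e₁) with hg'
    have hg'pos : 1 ≤ g' := by omega
    have hΔz : Δ = z ^ g' * Wd := by
      have hsplit : z ^ g = z ^ (e₀ + e₁) * z ^ g' := by rw [← pow_add]; congr 1; omega
      have h := hΔeq
      rw [hsplit, mul_assoc] at h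
      exact mul_left_cancel₀ (pow_ne_zero _ hz0) h
    -- `u₁` is a unit
    have hvu₁ : O.valuation u₁ = 1 := by
      rcases huni₁ with h | h
      · exact hu₁1 h
      · have hvv₁ : O.valuation v₁ = 1 := hv₁1 h
        by_contra hne
        have hlt : O.valuation u₁ < 1 := lt_of_le_of_ne (valuation_le_one_of_mem_locAtCentre hB''O hu₁) hne
        have h1 : O.valuation (u₀ * v₁) = 1 := by rw [map_mul, hvu₀, hvv₁, mul_one]
        have h2 : O.valuation (-(u₁ * v₀)) < 1 := by
          rw [Valuation.map_neg]; exact valuation_mul_lt_one_of_lt_of_mem O hlt (hRO hv₀)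
        have : O.valuation Δ = 1 := by
          rw [hΔ, sub_eq_add_neg, Valuation.map_add_eq_of_lt_left _ (by rw [h1]; exact h2), h1]
        rw [this] at hΔlt; exact lt_irrefl _ hΔlt
    have hu₁0 : u₁ ≠ 0 := ne_zero_of_valuation_eq_one hvu₁
    have hu₁inv : u₁⁻¹ ∈ locAtCentre B''.toSubring O := inv_mem_locAtCentre hu₁ hvu₁
    -- normal form
    set yt : K := Wd * yn * u₁⁻¹ with hyt
    have hytm : yt ∈ locAtCentre B''.toSubring O := Subring.mul_mem _ (Subring.mul_mem _ hWd h₂) hu₁inv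
    have hℓ₁nf : ℓ₁ = u₁ * u₀⁻¹ * (ℓ₀ + z ^ g' * yt) := by
      have : u₀ * ℓ₁ = u₁ * (ℓ₀ + z ^ g' * yt) := by
        rw [hℓ₁, hℓ₀, hyt]
        have : z ^ g' * (Wd * yn * u₁⁻¹) = Δ * yn * u₁⁻¹ := by rw [hΔz]; ring
        rw [mul_add u₁, this, hΔ]; field_simp; ring
      field_simp
      linear_combination this
    -- r.s.p. `(x̃, z, ỹ)` with `x̃ = ℓ₀`
    have hmaxT : maximalIdeal ↥(locAtCentre B''.toSubring O) = Ideal.span {⟨ℓ₀, hℓ₀m⟩, ⟨z, h₃⟩, ⟨yt, hytm⟩} := by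
      rw [hmax'']
      apply span_triple_eq_of_mem
      · exact mem_span_triple_of_eq h₁ hℓ₀m h₃ hytm u₀⁻¹ 0 (-(u₀⁻¹ * v₀ * u₁ * Wd⁻¹)) hu₀inv (Subring.zero_mem _)
          (Subring.neg_mem _ (Subring.mul_mem _ (Subring.mul_mem _ (Subring.mul_mem _ hu₀inv hv₀) hu₁) hWdinv))
          (by rw [hℓ₀, hyt]; field_simp; ring)
      · exact mem_span_triple_of_eq h₂ hℓ₀m h₃ hytm 0 0 (u₁ * Wd⁻¹) (Subring.zero_mem _) (Subring.zero_mem _)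
          (Subring.mul_mem _ hu₁ hWdinv) (by rw [hyt]; field_simp; try ring)
      · exact Ideal.subset_span (by simp)
      · exact mem_span_triple_of_eq hℓ₀m h₁ h₂ h₃ u₀ v₀ 0 hu₀ hv₀ (Subring.zero_mem _) (by rw [hℓ₀]; ring)
      · exact Ideal.subset_span (by simp)
      · exact mem_span_triple_of_eq hytm h₁ h₂ h₃ 0 (Wd * u₁⁻¹) 0 (Subring.zero_mem _) (Subring.mul_mem _ hWd hu₁inv) (Subring.zero_mem _)
          (by rw [hyt]; ring)
    -- depth of `x̃` below `z`
    have hvℓ₀₁ : O₁.valuation ℓ₀ < 1 := by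
      rw [hℓ₀]
      refine lt_of_le_of_lt (Valuation.map_add _ _ _) (max_lt ?_ ?_)
      · rw [mul_comm]; exact valuation_mul_lt_one_of_lt_of_mem O₁ hvxn₁ (hB''O₁.trans le_rfl |> fun h => hOO₁ (hRO hu₀))
      · rw [mul_comm]; exact valuation_mul_lt_one_of_lt_of_mem O₁ hvyn₁ (hOO₁ (hRO hv₀))
    have hdeep : ∀ m : ℕ, O.valuation ℓ₀ < O.valuation (z ^ (m + 1)) := fun m =>
      valuation_lt_of_lt_of_le hOO₁ (by rw [hvz₁N]; exact hvℓ₀₁)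
    -- the `g'` curve rounds in one call
    obtain ⟨A₂, hAA₂, hA₂fg, hA₂O, hreg₂, h12, k₁, k₂, k₃, hmax₂⟩ :=
      exists_model_rsop_div_pow O A hAfg hzd hdimA3 g' B'' hAB'' hB''fg hB''O hB''reg ℓ₀ z yt hℓ₀m h₃ hytm hmaxT hdeep
    haveI := isLocalRing_locAtCentre hA₂O
    have hdim₂ : ringKrullDim ↥(locAtCentre A₂.toSubring O) = 3 := by
      rw [ringKrullDim_locAtCentre_eq_of_isMaximal A₂ hA₂fg O hA₂O (hzd _ hA₂O fun w hw => hAA₂ hw), ringKrullDim_eq_of_fg_of_le hAfg hA₂fg hAA₂, hdimA3]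
    set x' : K := ℓ₀ / z ^ g' with hx'
    have hℓ₀x : ℓ₀ = z ^ g' * x' := by rw [hx']; field_simp
    have hQm : x' + yt ∈ locAtCentre A₂.toSubring O := Subring.add_mem _ k₁ (h12 hytm)
    -- r.s.p. `(z, x', x' + ỹ)`
    have hmaxP : maximalIdeal ↥(locAtCentre A₂.toSubring O) = Ideal.span {⟨z, k₂⟩, ⟨x', k₁⟩, ⟨x' + yt, hQm⟩} := by
      rw [hmax₂]
      apply span_triple_eq_of_mem
      · exact Ideal.subset_span (by simp [hx'])
      · exact Ideal.subset_span (by simp [hx'])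
      · exact mem_span_triple_of_eq k₃ k₂ k₁ hQm 0 (-1) 1 (Subring.zero_mem _) (Subring.neg_mem _ (Subring.one_mem _)) (Subring.one_mem _) (by ring)
      · exact Ideal.subset_span (by simp)
      · exact Ideal.subset_span (by simp [hx'])
      · exact mem_span_triple_of_eq hQm k₁ k₂ k₃ 1 0 1 (Subring.one_mem _) (Subring.zero_mem _) (Subring.one_mem _) (by ring)
    -- the representative on `A₂`
    set 𝒰 : K := Wa * (u₁ * u₀⁻¹) ^ n₁ with h𝒰
    have h𝒰m : 𝒰 ∈ locAtCentre A₂.toSubring O :=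
      Subring.mul_mem _ (h12 hWa) (Subring.pow_mem _ (Subring.mul_mem _ (h12 hu₁) (h12 hu₀inv)) _)
    have hv𝒰 : O.valuation 𝒰 = 1 := by
      rw [h𝒰, map_mul, map_pow, map_mul, map_inv₀, hvWa, hvu₁, hvu₀, inv_one, mul_one, one_pow, mul_one]
    have hf₀ : (z ^ (ea + e₀ + e₁ + g + e₀) * ℓ₀) ^ n₀ = z ^ ((ea + e₀ + e₁ + g + e₀ + g') * n₀) * x' ^ n₀ := by
      rw [hℓ₀x, ← mul_assoc, ← pow_add, mul_pow, ← pow_mul]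
    have hf₁ : (z ^ (ea + e₀ + e₁ + g + e₁) * ℓ₁) ^ n₁ = (u₁ * u₀⁻¹) ^ n₁ * z ^ ((ea + e₀ + e₁ + g + e₁ + g') * n₁) * (x' + yt) ^ n₁ := by
      rw [hℓ₁nf, hℓ₀x]
      have : z ^ (ea + e₀ + e₁ + g + e₁) * (u₁ * u₀⁻¹ * (z ^ g' * x' + z ^ g' * yt)) =
          (u₁ * u₀⁻¹) * z ^ (ea + e₀ + e₁ + g + e₁ + g') * (x' + yt) := by rw [pow_add]; ring
      rw [this, mul_pow, mul_pow, ← pow_mul]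
    have hG' : (∑ j : Fin p, c j ^ p * g₀ ^ (j : ℕ)) =
        𝒰 * z ^ (ea + (ea + e₀ + e₁ + g + e₀ + g') * n₀ + (ea + e₀ + e₁ + g + e₁ + g') * n₁) * x' ^ n₀ * (x' + yt) ^ n₁ := by
      rw [hG, hA₀z, hrow₀, hrow₁, hf₀, hf₁, h𝒰, pow_add, pow_add]; ring
    exact pack_two p hp O A A₂ hA₂O hAA₂ hA₂fg hreg₂ hdim₂ g₀ z x' (x' + yt) 𝒰 k₂ k₁ hQm h𝒰m hv𝒰 hz0 hmaxP c hc _ n₀ n₁ hn₀ hn₁ hG'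
  · /- NON-TANGENT case: `Δ` a unit, `(z, ℓ₀, ℓ₁)` is an r.s.p. of `locAtCentre B'' O` -/
    have hΔ0 : Δ ≠ 0 := ne_zero_of_valuation_eq_one hΔ1
    have hΔinv : Δ⁻¹ ∈ locAtCentre B''.toSubring O := inv_mem_locAtCentre hΔm hΔ1
    have hmaxN : maximalIdeal ↥(locAtCentre B''.toSubring O) = Ideal.span {⟨z, h₃⟩, ⟨ℓ₀, hℓ₀m⟩, ⟨ℓ₁, hℓ₁m⟩} := by
      rw [hmax'']
      apply span_triple_eq_of_mem
      · exact mem_span_triple_of_eq h₁ h₃ hℓ₀m hℓ₁m 0 (v₁ * Δ⁻¹) (-(v₀ * Δ⁻¹)) (Subring.zero_mem _) (Subring.mul_mem _ hv₁ hΔinv)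
          (Subring.neg_mem _ (Subring.mul_mem _ hv₀ hΔinv)) (by rw [hℓ₀, hℓ₁]; field_simp; rw [hΔ]; ring)
      · exact mem_span_triple_of_eq h₂ h₃ hℓ₀m hℓ₁m 0 (-(u₁ * Δ⁻¹)) (u₀ * Δ⁻¹) (Subring.zero_mem _)
          (Subring.neg_mem _ (Subring.mul_mem _ hu₁ hΔinv)) (Subring.mul_mem _ hu₀ hΔinv) (by rw [hℓ₀, hℓ₁]; field_simp; rw [hΔ]; ring)
      · exact Ideal.subset_span (by simp)
      · exact Ideal.subset_span (by simp)
      · exact mem_span_triple_of_eq hℓ₀m h₁ h₂ h₃ u₀ v₀ 0 hu₀ hv₀ (Subring.zero_mem _) (by rw [hℓ₀]; ring)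
      · exact mem_span_triple_of_eq hℓ₁m h₁ h₂ h₃ u₁ v₁ 0 hu₁ hv₁ (Subring.zero_mem _) (by rw [hℓ₁]; ring)
    have hG' : (∑ j : Fin p, c j ^ p * g₀ ^ (j : ℕ)) =
        Wa * z ^ (ea + (ea + e₀ + e₁ + g + e₀) * n₀ + (ea + e₀ + e₁ + g + e₁) * n₁) * ℓ₀ ^ n₀ * ℓ₁ ^ n₁ := by
      rw [hG, hA₀z, hrow₀, hrow₁, mul_pow, mul_pow, ← pow_mul, ← pow_mul, pow_add, pow_add]; ring
    exact pack_two p hp O A B'' hB''O hAB'' hB''fg hB''reg hB''dim g₀ z ℓ₀ ℓ₁ Wa h₃ hℓ₀m hℓ₁m hWa hvWa hz0 hmaxN c hc _ n₀ n₁ hn₀ hn₁ hG'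

end Summit.ResolutionOfSingularities.ResolutionOfSingularities.Theorems.RadicialJung.CleanModels.Ccurve

end
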